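import Literature.Computability.AlgebraicComplexity.AlderStrassenProofs
import Literature.RingTheory.DiscreteValuationRing.PowerSeriesExpansion
import Literature.Computability.AlgebraicComplexity.BLMW11HilbertKraftReduction
import Mathlib.Analysis.Complex.Polynomial.Basic
import HarnessLib

/-!
# Laurent points of Zariski closures (Hilbert 1893 / Kraft III.2.3) and BLMW 2011, Lemma 9.4.1

For a finitely generated commutative domain `S` over an algebraically closed field `K`, elements
`P_t ∈ S` and a point `z ∈ K^τ` satisfying every polynomial relation of the `P_t`, there is a
`K`-algebra homomorphism `Ψ : S → K((ε))` under which every `P_t` becomes a power series with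
constant coefficient `z_t` (`exists_laurentSeries_of_ker_le`; in words: a point of the Zariski
closure of the image of `Spec S` in `K^τ` is the limit `ε → 0` of the image of a `K((ε))`-point of
`Spec S`). This is the algebraic form of Kraft's Lemma III.2.3/1 used by
Bürgisser–Landsberg–Manivel–Weyman 2011, Lemma 9.4.1; with the reductions of
`BLMW11HilbertKraftReduction.lean` it DISCHARGES the named fact `BLMW2011_lemma_9_4_1`
(`BLMW2011_lemma_9_4_1_holds`, cell val-lit, row BLMW2011-B).

The proof is the curve-selection route of Bürgisser–Clausen–Shokrollahi, Lemmas (20.26)–(20.28),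
exactly as formalised for Alder's theorem in `AlderStrassenProofs.lean` (Chevalley's theorem on
the image, a line through the point by Noether normalisation and going-down, a closed point of the
generic fibre, a valuation ring of the resulting function field in one variable dominating the
point), with the truncation step of BCS Thm. (20.24) replaced by the full power-series expansion
of the discrete valuation ring `B_Q` with residue field `K`
(`Literature.RingTheory.DiscreteValuationRing.CoefficientField.exists_algHom_powerSeries`):
`exists_laurent_of_dedekind`, `exists_laurent_of_valuationSubring` (§1), the generic-fibre step
`exists_laurent_of_generic_fibre` and the curve lemma `exists_laurentSeries_of_ker_le` (§2), the
polynomial form `exists_laurentSeries_aeval` and the discharge (§3). Theorems only; no new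
definitions, no named facts.

Honest framing: a closure lemma of commutative algebra / GCT bookkeeping; nothing here bears on
lower bounds or on `VP` versus `VNP`.

## References

* [Kraft1984] H. Kraft, *Geometrische Methoden in der Invariantentheorie*, III.2.3 Lemma 1.
* [BurgisserEtAl2011] Bürgisser–Landsberg–Manivel–Weyman, arXiv:0907.2850, Lemma 9.4.1.
* [BurgisserClausenShokrollahi1997] *Algebraic Complexity Theory*, Lemmas (20.26)–(20.28).
-/

noncomputable section

open scoped BigOperators Polynomial
open MvPolynomial

namespace Literature.Computability.AlgebraicComplexity

namespace LaurentPoints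

open IntermediateField
open scoped IntermediateField.algebraAdjoinAdjoin
open Literature.RingTheory.DiscreteValuationRing

universe u v

/-! ### §1. Places: from a valuation ring of a function field in one variable to `K((ε))` -/

section Places

variable {K : Type u} [Field K] {F : Type v} [Field F] [Algebra K F]

/-- The embedding `K[[X]] → K((X))` as a `K`-algebra homomorphism. [cite: BurgisserEtAl2011, §9.4 (`R ⊂ K`)] -/
theorem exists_algHom_powerSeries_laurentSeries :
    ∃ j : PowerSeries K →ₐ[K] LaurentSeries K, Function.Injective j ∧
      ∀ q, j q = (q : LaurentSeries K) := by
  refine ⟨{ toRingHom := HahnSeries.ofPowerSeries ℤ K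
            commutes' := fun c => by
              change HahnSeries.ofPowerSeries ℤ K (algebraMap K (PowerSeries K) c) = _
              rw [HahnSeries.algebraMap_apply'] },
    HahnSeries.ofPowerSeries_injective, fun q => rfl⟩

/-- **`O = B_Q` expands into `K((ε))`** (BCS Lemma (20.28) with Kraft's completion step): for a
finitely generated `K`-algebra `B ⊆ O` (`K` algebraically closed) which is a Dedekind domain with
fraction field `F`, and a valuation ring `O ≠ F` of `F`, there is a `K`-algebra homomorphism
`Ψ : F → K((ε))` mapping `O` into `K[[ε]]` such that the constant coefficient of `Ψ e`, `e ∈ O`,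
is the residue of `e` (the unique constant `c` with `e − c ∈ 𝔪_O`).
[cite: Kraft1984, III.2.3 (proof of Lemma 1)] [cite: BurgisserClausenShokrollahi1997, Lemma (20.28) (proof)] -/
theorem exists_laurent_of_dedekind [IsAlgClosed K] {B : Type*} [CommRing B] [IsDedekindDomain B]
    [Algebra K B] [Algebra.FiniteType K B] [Algebra B F] [IsFractionRing B F]
    [IsScalarTower K B F] (O : ValuationSubring F) (hO : O ≠ ⊤)
    (hBO : ∀ b : B, algebraMap B F b ∈ O) :
    ∃ Ψ : F →ₐ[K] LaurentSeries K, ∀ e ∈ O, ∃ q : PowerSeries K,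
      Ψ e = (q : LaurentSeries K) ∧
        ∀ c : K, e - algebraMap K F c ∈ O.nonunits → PowerSeries.constantCoeff q = c := by
  classical
  -- the centre `Q = 𝔪_O ∩ B` of `O` on `B`
  let f : B →+* O :=
    { toFun := fun b => ⟨algebraMap B F b, hBO b⟩
      map_one' := Subtype.ext (by simp)
      map_mul' := fun a b => Subtype.ext (by simp)
      map_zero' := Subtype.ext (by simp)
      map_add' := fun a b => Subtype.ext (by simp) }
  set Q : Ideal B := (IsLocalRing.maximalIdeal O).comap f with hQdef
  have hQ : ∀ b, b ∈ Q ↔ algebraMap B F b ∈ O.nonunits := fun b => by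
    rw [hQdef, Ideal.mem_comap, ← ValuationSubring.coe_mem_nonunits_iff]
    rfl
  haveI hQp : Q.IsPrime := Ideal.comap_isPrime f _
  -- `Q ≠ 0` since `O ≠ F = Frac(B)`
  have hQ0 : Q ≠ ⊥ := by
    intro hQbot
    apply hO
    refine _root_.eq_top_iff.mpr fun w _ => ?_
    obtain ⟨b₁, b₂, hb₂, rfl⟩ := IsFractionRing.div_surjective (A := B) w
    have hb₂Q : b₂ ∉ Q := by
      rw [hQbot, Ideal.mem_bot]
      exact nonZeroDivisors.ne_zero hb₂
    rw [div_eq_mul_inv]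
    exact O.mul_mem _ _ (hBO b₁)
      (valuationSubring_inv_mem_of_notMem_nonunits O fun h => hb₂Q ((hQ b₂).mpr h))
  haveI hQm : Q.IsMaximal := Ring.DimensionLEOne.maximalOfPrime hQ0 hQp
  -- `D = B_Q` is a discrete valuation ring with residue field `K`
  haveI hDVR : IsDiscreteValuationRing (Localization.AtPrime Q) :=
    IsLocalization.AtPrime.isDiscreteValuationRing_of_dedekind_domain B hQ0 _
  have hres : ∀ w : Localization.AtPrime Q, ∃ c : K,
      w - algebraMap K (Localization.AtPrime Q) c ∈
        IsLocalRing.maximalIdeal (Localization.AtPrime Q) :=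
    fun w => exists_sub_algebraMap_mem_maximalIdeal_localization (K := K) Q w
  -- the canonical map `ℓ : B_Q → F`
  have hunits : ∀ s : Q.primeCompl, IsUnit (algebraMap B F s) := fun s =>
    IsUnit.mk0 _ fun h => s.2 (by
      rw [IsFractionRing.to_map_eq_zero_iff] at h
      rw [h]
      exact Q.zero_mem)
  set ℓ : Localization.AtPrime Q →+* F := IsLocalization.lift hunits with hℓdef
  have hℓ : ∀ b : B, ℓ (algebraMap B _ b) = algebraMap B F b := fun b =>
    IsLocalization.lift_eq hunits b
  have hℓK : ∀ c : K, ℓ (algebraMap K (Localization.AtPrime Q) c) = algebraMap K F c := by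
    intro c
    rw [IsScalarTower.algebraMap_apply K B (Localization.AtPrime Q), hℓ,
      ← IsScalarTower.algebraMap_apply]
  -- the power-series expansion of `B_Q` (brick D) and its extension to `F = Frac(B)`
  obtain ⟨ψ, hψinj, hψres, -, -⟩ := CoefficientField.exists_algHom_powerSeries hres
  obtain ⟨j, hjinj, hj⟩ := exists_algHom_powerSeries_laurentSeries (K := K)
  let g : B →ₐ[K] LaurentSeries K :=
    j.comp (ψ.comp (IsScalarTower.toAlgHom K B (Localization.AtPrime Q)))
  have hgapply : ∀ b : B, g b = (ψ (algebraMap B (Localization.AtPrime Q) b) : LaurentSeries K) :=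
    fun b => hj _
  have hg : Function.Injective g :=
    (hjinj.comp hψinj).comp (IsLocalization.injective (Localization.AtPrime Q)
      Q.primeCompl_le_nonZeroDivisors)
  refine ⟨IsFractionRing.liftAlgHom hg, fun e he => ?_⟩
  obtain ⟨d, hd⟩ := mem_range_lift_of_mem O Q ℓ hℓ hQ he
  refine ⟨ψ d, ?_, fun c hc => ?_⟩
  · -- `Ψ e = ψ d` (write `d = b/s`)
    obtain ⟨b, s, rfl⟩ := IsLocalization.exists_mk'_eq Q.primeCompl d
    have hs0 : g (s : B) ≠ 0 := fun h => s.2 (by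
      have : (s : B) = 0 := hg (by rw [h, map_zero])
      rw [this]
      exact Q.zero_mem)
    rw [← hd, lift_mk'_eq_div Q ℓ hℓ, map_div₀, IsFractionRing.liftAlgHom_apply,
      IsFractionRing.lift_algebraMap, IsFractionRing.liftAlgHom_apply,
      IsFractionRing.lift_algebraMap]
    change g b / g s = _
    rw [eq_comm, eq_div_iff hs0, hgapply, hgapply, ← hj, ← hj, ← map_mul, ← map_mul,
      IsLocalization.mk'_spec]
    exact hj _
  · -- the residue
    have h1 := hψres d
    have h2 : d - algebraMap K (Localization.AtPrime Q) c ∈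
        IsLocalRing.maximalIdeal (Localization.AtPrime Q) :=
      mem_maximalIdeal_of_lift_mem_nonunits O Q ℓ hℓ hBO hQ (by rwa [map_sub, hd, hℓK])
    have h3 : algebraMap K (Localization.AtPrime Q) (c - PowerSeries.constantCoeff (ψ d)) ∈
        IsLocalRing.maximalIdeal (Localization.AtPrime Q) := by
      have := Ideal.sub_mem _ h1 h2
      rwa [sub_sub_sub_cancel_left, ← map_sub] at this
    exact (sub_eq_zero.mp (CoefficientField.eq_zero_of_algebraMap_mem h3)).symm

/-- **A place of a function field in one variable expands into `K((ε))`** (BCS Lemma (20.28),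
Kraft III.2.3: "`𝒪̂ ≅ ℂ[[t]]`, `ℂ(C) ⊂ ℂ((t))`"): for `F/K` finitely generated of transcendence
degree `1` over an algebraically closed field `K` and a valuation ring `O ≠ F` of `F` containing
`K`, there is a `K`-algebra homomorphism `Ψ : F → K((ε))` mapping `O` into `K[[ε]]`, the constant
coefficient being the residue. [cite: Kraft1984, III.2.3 (proof of Lemma 1)]
[cite: BurgisserClausenShokrollahi1997, Lemma (20.28)] -/
theorem exists_laurent_of_valuationSubring [IsAlgClosed K] [Algebra.EssFiniteType K F]
    {x : F} (hx : Transcendental K x) (halg : Algebra.IsAlgebraic K⟮x⟯ F)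
    (O : ValuationSubring F) (hO : O ≠ ⊤) (hKO : ∀ c : K, algebraMap K F c ∈ O) :
    ∃ Ψ : F →ₐ[K] LaurentSeries K, ∀ e ∈ O, ∃ q : PowerSeries K,
      Ψ e = (q : LaurentSeries K) ∧
        ∀ c : K, e - algebraMap K F c ∈ O.nonunits → PowerSeries.constantCoeff q = c := by
  -- (a) a separating transcendental element `u ∈ O`
  obtain ⟨u, huO, hu, hsep⟩ := exists_separating_mem_valuationSubring hx halg O
  haveI := hsep
  -- (b) `A = K[u]` is a principal ideal domain and `F/K(u)` is finite (separable)
  haveI hPIR : IsPrincipalIdealRing (Algebra.adjoin K ({u} : Set F)) := by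
    have hmem : ∀ q : K[X], Polynomial.aeval u q ∈ Algebra.adjoin K ({u} : Set F) := fun q => by
      rw [Algebra.adjoin_singleton_eq_range_aeval]
      exact ⟨q, rfl⟩
    refine IsPrincipalIdealRing.of_surjective
      ((Polynomial.aeval u : K[X] →ₐ[K] F).toRingHom.codRestrict
        (Algebra.adjoin K ({u} : Set F)).toSubring hmem) ?_
    rintro ⟨v, hv⟩
    rw [Algebra.adjoin_singleton_eq_range_aeval] at hv
    obtain ⟨q, rfl⟩ := hv
    exact ⟨q, rfl⟩
  haveI : Algebra.IsAlgebraic K⟮u⟯ F := Algebra.IsSeparable.isAlgebraic K⟮u⟯ F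
  haveI hfd : FiniteDimensional K⟮u⟯ F := finiteDimensional_of_essFiniteType K⟮u⟯
  -- (c) `B` = integral closure of `A` in `F`: Dedekind, finite over `A`, `Frac(B) = F`
  haveI hT : IsScalarTower (Algebra.adjoin K ({u} : Set F))
      (integralClosure (Algebra.adjoin K ({u} : Set F)) F) F :=
    IsScalarTower.subalgebra' _ _ _ _
  haveI hT' : IsScalarTower K (Algebra.adjoin K ({u} : Set F))
      (integralClosure (Algebra.adjoin K ({u} : Set F)) F) :=
    IsScalarTower.of_algebraMap_eq fun _ => rfl
  haveI hT'' : IsScalarTower K (integralClosure (Algebra.adjoin K ({u} : Set F)) F) F :=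
    IsScalarTower.of_algebraMap_eq fun _ => rfl
  haveI hBD : IsDedekindDomain (integralClosure (Algebra.adjoin K ({u} : Set F)) F) :=
    integralClosure.isDedekindDomain (Algebra.adjoin K ({u} : Set F)) K⟮u⟯ F
  haveI hBfin : Module.Finite (Algebra.adjoin K ({u} : Set F))
      (integralClosure (Algebra.adjoin K ({u} : Set F)) F) :=
    IsIntegralClosure.finite (Algebra.adjoin K ({u} : Set F)) K⟮u⟯ F _
  haveI hBfrac : IsFractionRing (integralClosure (Algebra.adjoin K ({u} : Set F)) F) F :=
    integralClosure.isFractionRing_of_finite_extension K⟮u⟯ F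
  haveI hAft : Algebra.FiniteType K (Algebra.adjoin K ({u} : Set F)) :=
    Algebra.FiniteType.adjoin_of_finite (Set.finite_singleton u)
  haveI hBft : Algebra.FiniteType K (integralClosure (Algebra.adjoin K ({u} : Set F)) F) :=
    hAft.trans (Module.Finite.finiteType (integralClosure (Algebra.adjoin K ({u} : Set F)) F))
  -- (d) `B ⊆ O`: `A ⊆ O` and `O` is integrally closed
  let OK : Subalgebra K F := { O.toSubring with algebraMap_mem' := hKO }
  have hAO : Algebra.adjoin K ({u} : Set F) ≤ OK :=
    Algebra.adjoin_le (Set.singleton_subset_iff.mpr huO)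
  have hBO : ∀ b : integralClosure (Algebra.adjoin K ({u} : Set F)) F,
      algebraMap _ F b ∈ O := by
    intro b
    have hb : IsIntegral (Algebra.adjoin K ({u} : Set F)) (b : F) := b.2
    obtain ⟨q, hqm, hq⟩ := hb
    let g : Algebra.adjoin K ({u} : Set F) →+* O :=
      { toFun := fun a => ⟨(a : F), hAO a.2⟩
        map_one' := Subtype.ext (by simp)
        map_mul' := fun a b => Subtype.ext (by simp)
        map_zero' := Subtype.ext (by simp)
        map_add' := fun a b => Subtype.ext (by simp) }
    have hg : (algebraMap O F).comp g = algebraMap (Algebra.adjoin K ({u} : Set F)) F :=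
      RingHom.ext fun a => rfl
    refine valuationSubring_mem_of_isIntegral O ⟨q.map g, hqm.map g, ?_⟩
    rw [Polynomial.eval₂_map, hg]
    exact hq
  exact exists_laurent_of_dedekind O hO hBO

end Places

/-! ### §2. The curve lemma with Laurent-series conclusion -/

section CurveLemma

variable {K : Type u} [Field K]

/-- **Chevalley's theorem for `Spec S → Spec K[y_τ]`, on prime ideals** (variant of
`exists_notMem_ker_forall_isPrime_exists_comap_eq` of `AlderStrassenProofs.lean` for a finitely
generated domain `S` in place of a polynomial ring): there is `g ∉ ker f` such that every prime
`𝔔 ⊇ ker f` with `g ∉ 𝔔` is the contraction of a prime of `S`.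
[cite: BurgisserClausenShokrollahi1997, Lemma (20.27) (proof)] -/
theorem exists_notMem_ker_forall_isPrime_exists_comap_eq_of_finiteType {τ : Type*} [Finite τ]
    {S : Type*} [CommRing S] [IsDomain S] [Algebra K S] [Algebra.FiniteType K S]
    (f : MvPolynomial τ K →ₐ[K] S) :
    ∃ g : MvPolynomial τ K, g ∉ RingHom.ker f ∧
      ∀ 𝔔 : Ideal (MvPolynomial τ K), 𝔔.IsPrime → RingHom.ker f ≤ 𝔔 → g ∉ 𝔔 →
        ∃ Q : Ideal S, Q.IsPrime ∧ Q.comap (f : MvPolynomial τ K →+* S) = 𝔔 := by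
  classical
  set f' : MvPolynomial τ K →+* S := (f : MvPolynomial τ K →+* S) with hfdef
  have hkerf : RingHom.ker f' = RingHom.ker f := rfl
  have hfp : f'.FinitePresentation := by
    refine RingHom.FinitePresentation.of_finiteType.mp ?_
    refine RingHom.FiniteType.of_comp_finiteType (f := algebraMap K (MvPolynomial τ K)) ?_
    have : f'.comp (algebraMap K (MvPolynomial τ K)) = algebraMap K S := f.comp_algebraMap
    rw [this]
    exact RingHom.finiteType_algebraMap.mpr inferInstance
  set T : Set (PrimeSpectrum (MvPolynomial τ K)) := Set.range (PrimeSpectrum.comap f') with hTdef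
  have hTcons : Topology.IsConstructible T := by
    have h := PrimeSpectrum.isConstructible_comap_image hfp Topology.IsConstructible.univ
    rwa [Set.image_univ] at h
  have hclT : closure T = PrimeSpectrum.zeroLocus (RingHom.ker f') :=
    PrimeSpectrum.closure_range_comap f'
  have hirr : IsIrreducible (closure T) := by
    refine IsIrreducible.closure ?_
    rw [hTdef, ← Set.image_univ]
    exact (IrreducibleSpace.isIrreducible_univ _).image _
      (PrimeSpectrum.continuous_comap f').continuousOn
  obtain ⟨O, hO, ⟨p, hpO, hpcl⟩, hOT⟩ :=
    Literature.NumberTheory.Automorphic.exists_isOpen_inter_closure_subset_of_isConstructible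
      hTcons hirr
  obtain ⟨_, ⟨g, rfl⟩, hpg, hgO⟩ :=
    PrimeSpectrum.isTopologicalBasis_basic_opens.exists_subset_of_mem_open hpO hO
  refine ⟨g, ?_, ?_⟩
  · intro hg
    rw [hclT, PrimeSpectrum.mem_zeroLocus, SetLike.coe_subset_coe] at hpcl
    exact (PrimeSpectrum.mem_basicOpen g p).mp hpg (hpcl (hkerf ▸ hg))
  · intro 𝔔 h𝔔 hle hg𝔔
    set q : PrimeSpectrum (MvPolynomial τ K) := ⟨𝔔, h𝔔⟩ with hqdef
    have hqT : q ∈ T := by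
      refine hOT ⟨hgO ?_, ?_⟩
      · show q ∈ (PrimeSpectrum.basicOpen g : Set (PrimeSpectrum (MvPolynomial τ K)))
        rw [SetLike.mem_coe, PrimeSpectrum.mem_basicOpen]
        exact hg𝔔
      · rw [hclT, PrimeSpectrum.mem_zeroLocus, SetLike.coe_subset_coe, hkerf]
        exact hle
    obtain ⟨Q, hQ⟩ := hqT
    refine ⟨Q.asIdeal, Q.isPrime, ?_⟩
    have := congrArg PrimeSpectrum.asIdeal hQ
    rwa [PrimeSpectrum.comap_asIdeal] at this

open IntermediateField in
/-- **The generic-fibre step with Laurent-series conclusion** (variant of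
`exists_curve_of_generic_fibre` of `AlderStrassenProofs.lean`: BCS Lemmas (20.27)–(20.28), the
truncation replaced by the power-series expansion of §1): in the situation of the curve
selection (`R = K[y]/ker`, the point `𝔪`, the line `Lmap`, the curve `𝔮 ⊆ 𝔪`, the lift `D₀`
of the curve to the source `A`, a closed point of the generic fibre with residue field `E`),
there is a `K`-algebra homomorphism `Ψ : A → K((ε))` under which each `P_t` becomes a power
series with constant coefficient `z_t`.
[cite: BurgisserClausenShokrollahi1997, Lemmas (20.27), (20.28)] [cite: Kraft1984, III.2.3 Lemma 1 (proof)] -/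
theorem exists_laurent_of_generic_fibre [IsAlgClosed K] {τ : Type*}
    {A : Type*} [CommRing A] [Algebra K A] (P : τ → A) (z : τ → K)
    {R : Type*} [CommRing R] [IsDomain R] [Algebra K R] (𝔪 : Ideal R) [𝔪.IsMaximal]
    {s : ℕ} (ν : MvPolynomial (Fin s) K →ₐ[K] R)
    (hνint : (ν : MvPolynomial (Fin s) K →+* R).IsIntegral)
    (Lmap : MvPolynomial (Fin s) K →ₐ[K] K[X])
    (𝔮 : Ideal R) [𝔮.IsPrime] (h𝔮le : 𝔮 ≤ 𝔪)
    (h𝔮comap : 𝔮.comap (ν : MvPolynomial (Fin s) K →+* R) = RingHom.ker Lmap)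
    {gbar : R} (hg𝔪 : gbar ∈ 𝔪) (hg𝔮 : gbar ∉ 𝔮)
    {D₀ : Type*} [CommRing D₀] [Algebra K D₀] [Algebra.FiniteType K D₀]
    (πA : A →ₐ[K] D₀) (φR : R →ₐ[K] D₀) (hkerφR : ∀ r, φR r = 0 ↔ r ∈ 𝔮)
    (hχ : ∀ t, ∃ r ∈ 𝔪, φR r = πA (P t) - algebraMap K D₀ (z t))
    {w₀ : MvPolynomial (Fin s) K} (hw₀ : Lmap w₀ = Polynomial.X)
    (T : Submonoid D₀) (hlT : ∀ q : K[X], q ≠ 0 → Polynomial.aeval (φR (ν w₀)) q ∈ T)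
    (hTsub : ∀ w ∈ T, ∃ q : K[X], Polynomial.aeval (φR (ν w₀)) q = w)
    {L : Type*} [CommRing L] [Algebra D₀ L] [Algebra K L] [IsScalarTower K D₀ L]
    [IsLocalization T L] {E : Type*} [Field E] [Algebra K E] [Algebra.EssFiniteType K E]
    (ψ : L →ₐ[K] E) (hψsurj : Function.Surjective ψ) :
    ∃ Ψ : A →ₐ[K] LaurentSeries K, ∀ t, ∃ q : PowerSeries K,
      Ψ (P t) = (q : LaurentSeries K) ∧ PowerSeries.constantCoeff q = z t := by
  classical
  -- `Λ = φR ∘ ν : K[y] → D₀` factors through the line: `Λ = (aeval l₀) ∘ Lmap`, `l₀ = Λ(w₀)`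
  have hkerΛ : ∀ q, φR (ν q) = 0 ↔ Lmap q = 0 := by
    intro q
    rw [hkerφR, ← RingHom.mem_ker]
    have e : ν q ∈ 𝔮 ↔ q ∈ Ideal.comap (ν : MvPolynomial (Fin s) K →+* R) 𝔮 :=
      Ideal.mem_comap.symm
    rw [e, h𝔮comap]
  set l₀ : D₀ := φR (ν w₀) with hl₀def
  have hΛ : ∀ q, φR (ν q) = Polynomial.aeval l₀ (Lmap q) := by
    intro q
    have h1 : Lmap (q - Polynomial.aeval w₀ (Lmap q)) = 0 := by
      rw [map_sub, ← Polynomial.aeval_algHom_apply, hw₀, Polynomial.aeval_X_left_apply, sub_self]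
    have h2 := (hkerΛ _).mpr h1
    rw [map_sub, map_sub, sub_eq_zero] at h2
    rw [h2]
    change (φR.comp ν) (Polynomial.aeval w₀ (Lmap q)) = Polynomial.aeval ((φR.comp ν) w₀) (Lmap q)
    rw [Polynomial.aeval_algHom_apply]
  -- the field `E`: transcendence degree `1`
  have hlF : Transcendental K (ψ (algebraMap D₀ L l₀)) := transcendental_of_localization T hlT ψ
  have halg := isAlgebraic_adjoin_of_localization T hTsub ψ hψsurj
  -- the maps `ψ' : D₀ → E` and `ψR : R → E`
  set ψ' : D₀ →ₐ[K] E := ψ.comp (IsScalarTower.toAlgHom K D₀ L) with hψ'def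
  have hψ' : ∀ d, ψ' d = ψ (algebraMap D₀ L d) := fun d => rfl
  set ψR : R →ₐ[K] E := ψ'.comp φR with hψRdef
  -- `ker ψR = 𝔮` (incomparability for the integral extension `K[y] → R`)
  have hle : 𝔮 ≤ RingHom.ker ψR := fun r hr => by
    rw [RingHom.mem_ker, hψRdef, AlgHom.comp_apply, (hkerφR r).mpr hr, map_zero]
  have hkerψR : RingHom.ker ψR = 𝔮 := by
    refine le_antisymm ?_ hle
    by_contra hnot
    have hlt : 𝔮 < RingHom.ker ψR := lt_of_le_of_ne hle fun heq => hnot heq.ge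
    letI algSR : Algebra (MvPolynomial (Fin s) K) R := (ν : MvPolynomial (Fin s) K →+* R).toAlgebra
    haveI : Algebra.IsIntegral (MvPolynomial (Fin s) K) R := ⟨fun x => hνint x⟩
    haveI : (RingHom.ker ψR).IsPrime := RingHom.ker_isPrime _
    have hclt := Ideal.IsIntegral.comap_lt_comap (R := MvPolynomial (Fin s) K) hlt
    change Ideal.comap (ν : MvPolynomial (Fin s) K →+* R) 𝔮 <
      Ideal.comap (ν : MvPolynomial (Fin s) K →+* R) (RingHom.ker ψR) at hclt
    rw [h𝔮comap] at hclt
    have h2 : Ideal.comap (ν : MvPolynomial (Fin s) K →+* R) (RingHom.ker ψR) ≤ RingHom.ker Lmap := by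
      intro q hq
      rw [Ideal.mem_comap, RingHom.mem_ker, RingHom.coe_coe, hψRdef, AlgHom.comp_apply, hΛ, hψ',
        ← hψ', ← Polynomial.aeval_algHom_apply, hψ'] at hq
      rw [RingHom.mem_ker]
      exact (injective_iff_map_eq_zero _).mp (transcendental_iff_injective.mp hlF) _ hq
    exact lt_irrefl _ (hclt.trans_le h2)
  -- the valuation ring `O` dominating `(R/𝔮)_𝔪`
  set ρ : R →+* (ψR : R →+* E).range := (ψR : R →+* E).rangeRestrict with hρdef
  have hρsurj : Function.Surjective ρ := RingHom.rangeRestrict_surjective _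
  have hρker : RingHom.ker ρ = 𝔮 := by
    rw [hρdef, RingHom.ker_rangeRestrict]
    exact hkerψR
  have h𝔪' : 𝔪.map ρ ≠ ⊤ := by
    intro htop
    have h1 : (1 : (ψR : R →+* E).range) ∈ 𝔪.map ρ := htop ▸ Submodule.mem_top
    rw [Ideal.mem_map_iff_of_surjective ρ hρsurj] at h1
    obtain ⟨r, hr, hr1⟩ := h1
    have hker : r - 1 ∈ RingHom.ker ρ := by
      rw [RingHom.mem_ker, map_sub, hr1, map_one, sub_self]
    rw [hρker] at hker
    have h1𝔪 : (1 : R) ∈ 𝔪 := by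
      have := 𝔪.sub_mem hr (h𝔮le hker)
      rwa [sub_sub_cancel] at this
    exact Ideal.IsMaximal.ne_top ‹_› ((Ideal.eq_top_iff_one _).mpr h1𝔪)
  obtain ⟨O, hRO, hIO⟩ := Ideal.image_subset_nonunits_valuationSubring (𝔪.map ρ) h𝔪'
  have hψRO : ∀ r, ψR r ∈ O := fun r => hRO ⟨r, rfl⟩
  have hψR𝔪 : ∀ r ∈ 𝔪, ψR r ∈ O.nonunits := fun r hr =>
    hIO ⟨ρ r, Ideal.mem_map_of_mem ρ hr, rfl⟩
  have hKO : ∀ cK : K, algebraMap K E cK ∈ O := fun cK => by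
    rw [← ψR.commutes cK]
    exact hψRO _
  have hO : O ≠ ⊤ := by
    intro hOtop
    have h1 : ψR gbar ∈ O.nonunits := hψR𝔪 _ hg𝔪
    have h2 : ψR gbar ≠ 0 := by
      intro h0
      have : gbar ∈ RingHom.ker ψR := h0
      rw [hkerψR] at this
      exact hg𝔮 this
    rcases (ValuationSubring.mem_nonunits_iff_or (A := O)).mp h1 with h0 | hinv
    · exact h2 h0
    · exact hinv (hOtop ▸ ValuationSubring.mem_top _)
  -- the values `y_t = ψ' π P_t` and the congruences `y_t ≡ z_t (mod 𝔪_O)`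
  have hyz : ∀ t, ψ' (πA (P t)) - algebraMap K E (z t) ∈ O.nonunits ∧ ψ' (πA (P t)) ∈ O := by
    intro t
    obtain ⟨r, hr, hrt⟩ := hχ t
    have h1 : ψ' (πA (P t)) - algebraMap K E (z t) = ψR r := by
      change _ = ψ' (φR r)
      rw [hrt, map_sub, AlgHom.commutes]
    refine ⟨h1 ▸ hψR𝔪 r hr, ?_⟩
    have h2 : ψ' (πA (P t)) = ψR r + algebraMap K E (z t) := by rw [← h1, sub_add_cancel]
    rw [h2]
    exact O.add_mem _ _ (hψRO r) (hKO _)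
  -- conclude by §1
  obtain ⟨ΨE, hΨE⟩ := exists_laurent_of_valuationSubring hlF halg O hO hKO
  refine ⟨ΨE.comp (ψ'.comp πA), fun t => ?_⟩
  obtain ⟨q, hq, hqres⟩ := hΨE _ (hyz t).2
  exact ⟨q, hq, hqres _ (hyz t).1⟩

/-- **The curve lemma, Laurent form** (BCS Lemma (20.28) in coordinates, with Kraft's completion
step): for a finitely generated commutative domain `S` over an algebraically closed field `K`,
elements `P_t ∈ S` and a point `z ∈ K^τ` such that every polynomial relation of the `P_t`
vanishes at `z` (`ker (P^*) ≤ 𝔪_z`), there is a `K`-algebra homomorphism `Ψ : S → K((ε))` under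
which every `P_t` is a power series with constant coefficient `z_t`.
[cite: BurgisserClausenShokrollahi1997, Lemma (20.28)] [cite: Kraft1984, III.2.3 Lemma 1] -/
theorem exists_laurentSeries_of_ker_le [IsAlgClosed K] {τ : Type*} [Finite τ]
    {S : Type*} [CommRing S] [IsDomain S] [Algebra K S] [Algebra.FiniteType K S]
    (P : τ → S) {z : τ → K}
    (hz : RingHom.ker (aeval P : MvPolynomial τ K →ₐ[K] S) ≤
      RingHom.ker (aeval z : MvPolynomial τ K →ₐ[K] K)) :
    ∃ Ψ : S →ₐ[K] LaurentSeries K, ∀ t, ∃ q : PowerSeries K,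
      Ψ (P t) = (q : LaurentSeries K) ∧ PowerSeries.constantCoeff q = z t := by
  classical
  set f : MvPolynomial τ K →ₐ[K] S := aeval P with hfdef
  obtain ⟨g, hgI, hg⟩ := exists_notMem_ker_forall_isPrime_exists_comap_eq_of_finiteType (K := K) f
  have hfX : ∀ t, f (X t) = P t := fun t => by rw [hfdef, aeval_X]
  by_cases hgz : aeval z g ≠ 0
  · /- Case 1: `z` lies in the image of `Spec S` (`g(z) ≠ 0`): a closed point of `S` over `z`. -/
    haveI hzprime : (RingHom.ker (aeval z : MvPolynomial τ K →ₐ[K] K)).IsPrime :=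
      RingHom.ker_isPrime _
    obtain ⟨Q, hQ, hQc⟩ := hg _ hzprime hz (by rwa [RingHom.mem_ker])
    obtain ⟨n, hnmax, hQn⟩ := Ideal.exists_le_maximal Q hQ.ne_top
    have hmax : (RingHom.ker (aeval z : MvPolynomial τ K →ₐ[K] K)).IsMaximal :=
      RingHom.ker_isMaximal_of_surjective (aeval z : MvPolynomial τ K →ₐ[K] K)
        fun c => ⟨C c, by simp⟩
    have heq : n.comap (f : MvPolynomial τ K →+* S) =
        RingHom.ker (aeval z : MvPolynomial τ K →ₐ[K] K) :=
      (hmax.eq_of_le (Ideal.comap_ne_top _ hnmax.ne_top) (hQc ▸ Ideal.comap_mono hQn)).symm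
    -- the residue field `S/n` is `K`
    letI := Ideal.Quotient.field n
    haveI : Module.Finite K (S ⧸ n) := finite_of_finite_type_of_isJacobsonRing K (S ⧸ n)
    haveI : Algebra.IsIntegral K (S ⧸ n) := Algebra.IsIntegral.of_finite K (S ⧸ n)
    have hbij := IsAlgClosed.algebraMap_bijective_of_isIntegral (k := K) (K := S ⧸ n)
    let e : K ≃ₐ[K] (S ⧸ n) := AlgEquiv.ofBijective (Algebra.ofId K (S ⧸ n)) hbij
    let χ : S →ₐ[K] K := (e.symm : (S ⧸ n) →ₐ[K] K).comp (Ideal.Quotient.mkₐ K n)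
    have hχz : ∀ t, χ (P t) = z t := by
      intro t
      have hmem : X t - C (z t) ∈ RingHom.ker (aeval z : MvPolynomial τ K →ₐ[K] K) := by
        rw [RingHom.mem_ker, map_sub, aeval_X, aeval_C]
        exact sub_self _
      rw [← heq, Ideal.mem_comap, RingHom.coe_coe, map_sub, hfX, hfdef, aeval_C] at hmem
      have h0 : χ (P t - algebraMap K S (z t)) = 0 := by
        change (e.symm : (S ⧸ n) →ₐ[K] K) (Ideal.Quotient.mkₐ K n (P t - algebraMap K S (z t))) = 0
        rw [Ideal.Quotient.mkₐ_eq_mk, Ideal.Quotient.eq_zero_iff_mem.mpr hmem, map_zero]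
      rw [map_sub, AlgHom.commutes, sub_eq_zero] at h0
      exact h0
    refine ⟨(Algebra.ofId K (LaurentSeries K)).comp χ, fun t => ⟨PowerSeries.C (z t), ?_, ?_⟩⟩
    · rw [AlgHom.comp_apply, hχz, Algebra.ofId_apply, HahnSeries.algebraMap_apply']
      rfl
    · exact PowerSeries.constantCoeff_C _
  · /- Case 2: `g(z) = 0`. Curve selection. -/
    push Not at hgz
    -- `R = K[y]/I`, `I = ker f`, the point `𝔪 = ker χ_z`, `ḡ ∈ 𝔪 ∖ 0`
    set I : Ideal (MvPolynomial τ K) := RingHom.ker f with hIdef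
    haveI hIprime : I.IsPrime := RingHom.ker_isPrime _
    set χ : (MvPolynomial τ K ⧸ I) →ₐ[K] K := Ideal.Quotient.liftₐ I (aeval z) (fun a ha => hz ha)
      with hχdef
    set 𝔪 : Ideal (MvPolynomial τ K ⧸ I) := RingHom.ker χ with h𝔪def
    haveI h𝔪max : 𝔪.IsMaximal :=
      RingHom.ker_isMaximal_of_surjective χ fun c => ⟨algebraMap K _ c, by simp⟩
    have hχmk : ∀ b, χ (Ideal.Quotient.mk I b) = aeval z b := fun b => rfl
    have hgbar0 : Ideal.Quotient.mk I g ≠ 0 := by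
      rw [Ne, Ideal.Quotient.eq_zero_iff_mem]
      exact hgI
    have hgbar𝔪 : Ideal.Quotient.mk I g ∈ 𝔪 := by
      rw [h𝔪def, RingHom.mem_ker, hχmk, hgz]
    -- curve selection in `Y = Spec R` (AlderStrassenProofs §D)
    obtain ⟨s, ν, c, a, 𝔮, -, hνint, hLsurj, h𝔮prime, h𝔮le, hg𝔮, h𝔮comap⟩ :=
      exists_prime_le_liesOver_line (K := K) 𝔪 hgbar𝔪 hgbar0
    haveI := h𝔮prime
    set Lmap : MvPolynomial (Fin s) K →ₐ[K] K[X] :=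
      MvPolynomial.aeval (fun i => Polynomial.C (c i) + Polynomial.C (a i) * Polynomial.X)
      with hLdef
    -- lift `𝔮` to a prime `Q₀` of `S` (Chevalley)
    set 𝔔 : Ideal (MvPolynomial τ K) := 𝔮.comap (Ideal.Quotient.mk I) with h𝔔def
    haveI h𝔔prime : 𝔔.IsPrime := Ideal.comap_isPrime _ _
    have hI𝔔 : I ≤ 𝔔 := fun b hb => by
      rw [h𝔔def, Ideal.mem_comap, Ideal.Quotient.eq_zero_iff_mem.mpr hb]
      exact 𝔮.zero_mem
    obtain ⟨Q₀, hQ₀, hQ₀c⟩ := hg 𝔔 h𝔔prime hI𝔔 hg𝔮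
    haveI := hQ₀
    -- `D₀ = S/Q₀ ⊇ R/𝔮`
    set πA : S →ₐ[K] (S ⧸ Q₀) := Ideal.Quotient.mkₐ K Q₀ with hπAdef
    set φR : (MvPolynomial τ K ⧸ I) →ₐ[K] (S ⧸ Q₀) :=
      Ideal.Quotient.liftₐ I (πA.comp f) (fun b hb => by
        rw [hIdef, RingHom.mem_ker] at hb
        rw [AlgHom.comp_apply, hb, map_zero]) with hφRdef
    have hφR : ∀ b, φR (Ideal.Quotient.mk I b) = Ideal.Quotient.mk Q₀ (f b) := fun b => rfl
    have hkerφR : ∀ r, φR r = 0 ↔ r ∈ 𝔮 := by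
      intro r
      obtain ⟨b, rfl⟩ := Ideal.Quotient.mk_surjective r
      rw [hφR, Ideal.Quotient.eq_zero_iff_mem]
      have e : f b ∈ Q₀ ↔ b ∈ Ideal.comap (f : MvPolynomial τ K →+* S) Q₀ := Ideal.mem_comap.symm
      rw [e, hQ₀c, h𝔔def, Ideal.mem_comap]
    have hχ' : ∀ t, ∃ r ∈ 𝔪, φR r = πA (P t) - algebraMap K _ (z t) := by
      intro t
      refine ⟨Ideal.Quotient.mk I (X t - C (z t)), ?_, ?_⟩
      · rw [h𝔪def, RingHom.mem_ker, hχmk, map_sub, aeval_X, aeval_C, Algebra.algebraMap_self_apply,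
          sub_self]
      · rw [hφR, map_sub, hfX, hfdef, aeval_C, map_sub, hπAdef, Ideal.Quotient.mkₐ_eq_mk,
          Ideal.Quotient.mk_algebraMap]
    -- the generic fibre over the line: `T = K[l₀] ∖ 0`
    obtain ⟨w₀, hw₀⟩ := hLsurj Polynomial.X
    have hkerΛ : ∀ q, φR (ν q) = 0 ↔ Lmap q = 0 := by
      intro q
      rw [hkerφR, ← RingHom.mem_ker]
      have e : ν q ∈ 𝔮 ↔
          q ∈ Ideal.comap (ν : MvPolynomial (Fin s) K →+* (MvPolynomial τ K ⧸ I)) 𝔮 :=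
        Ideal.mem_comap.symm
      rw [e, h𝔮comap]
    have hΛ : ∀ q, φR (ν q) = Polynomial.aeval (φR (ν w₀)) (Lmap q) := by
      intro q
      have h1 : Lmap (q - Polynomial.aeval w₀ (Lmap q)) = 0 := by
        rw [map_sub, ← Polynomial.aeval_algHom_apply, hw₀, Polynomial.aeval_X_left_apply, sub_self]
      have h2 := (hkerΛ _).mpr h1
      rw [map_sub, map_sub, sub_eq_zero] at h2
      rw [h2]
      change (φR.comp ν) (Polynomial.aeval w₀ (Lmap q)) =
        Polynomial.aeval ((φR.comp ν) w₀) (Lmap q)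
      rw [Polynomial.aeval_algHom_apply]
    have hlinj : ∀ q : K[X], q ≠ 0 → Polynomial.aeval (φR (ν w₀)) q ≠ 0 := by
      intro q hq h0
      obtain ⟨q', rfl⟩ := hLsurj q
      rw [← hΛ] at h0
      exact hq ((hkerΛ q').mp h0)
    set T : Submonoid (S ⧸ Q₀) :=
      (nonZeroDivisors K[X]).map
        (Polynomial.aeval (φR (ν w₀)) : K[X] →ₐ[K] S ⧸ Q₀) with hTdef
    have hlT : ∀ q : K[X], q ≠ 0 → Polynomial.aeval (φR (ν w₀)) q ∈ T := fun q hq =>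
      ⟨q, mem_nonZeroDivisors_of_ne_zero hq, rfl⟩
    have hTsub : ∀ w ∈ T, ∃ q : K[X], Polynomial.aeval (φR (ν w₀)) q = w :=
      fun w ⟨q, _, hq⟩ => ⟨q, hq⟩
    have hT0 : T ≤ nonZeroDivisors (S ⧸ Q₀) := by
      rintro _ ⟨q, hq, rfl⟩
      exact mem_nonZeroDivisors_of_ne_zero (hlinj q (nonZeroDivisors.ne_zero hq))
    haveI : IsDomain (Localization T) := IsLocalization.isDomain_localization hT0
    -- a closed point `M` of the generic fibre and its residue field `E = T⁻¹D₀ / M`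
    obtain ⟨M, hM⟩ := @Ideal.exists_maximal (Localization T)
      (@CommSemiring.toSemiring _ (@CommRing.toCommSemiring (Localization T) inferInstance)) _
    letI := Ideal.Quotient.field M
    exact exists_laurent_of_generic_fibre P z 𝔪 ν hνint Lmap 𝔮 h𝔮le h𝔮comap hgbar𝔪 hg𝔮
      πA φR hkerφR hχ' hw₀ T hlT hTsub (L := Localization T) (E := Localization T ⧸ M)
      (Ideal.Quotient.mkₐ K M) (Ideal.Quotient.mkₐ_surjective K M)

end CurveLemma

/-! ### §3. Polynomial form and the discharge of BLMW 2011, Lemma 9.4.1 -/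

section Core

variable {K : Type u} [Field K]

/-- **Laurent points of closure points, polynomial form** (= hypothesis CORE of
`BLMW2011_lemma_9_4_1_of_core`): for a finitely generated commutative domain `R` over an
algebraically closed field `K`, a finite family `a : n → R` and a point `y ∈ Kⁿ` satisfying
all polynomial relations of `a`, there is a `K`-algebra homomorphism `Ψ : R → K((ε))` such that
every `Ψ(p(a))` is a power series with constant coefficient `p(y)`.
[cite: Kraft1984, III.2.3 Lemma 1] [cite: BurgisserClausenShokrollahi1997, Lemma (20.28)] -/
theorem exists_laurentSeries_aeval [IsAlgClosed K] {n : Type*} [Fintype n]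
    {R : Type*} [CommRing R] [IsDomain R] [Algebra K R] [Algebra.FiniteType K R]
    (a : n → R) (y : n → K) (hrel : ∀ p : MvPolynomial n K, aeval a p = 0 → aeval y p = 0) :
    ∃ Ψ : R →ₐ[K] LaurentSeries K, ∀ p : MvPolynomial n K, ∃ q : PowerSeries K,
      Ψ (aeval a p) = (q : LaurentSeries K) ∧ PowerSeries.constantCoeff q = aeval y p := by
  classical
  have hz : RingHom.ker (aeval a : MvPolynomial n K →ₐ[K] R) ≤
      RingHom.ker (aeval y : MvPolynomial n K →ₐ[K] K) := fun p hp => by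
    rw [RingHom.mem_ker] at hp ⊢
    exact hrel p hp
  obtain ⟨Ψ, hΨ⟩ := exists_laurentSeries_of_ker_le a hz
  choose q hq hq0 using hΨ
  obtain ⟨j, -, hj⟩ := exists_algHom_powerSeries_laurentSeries (K := K)
  refine ⟨Ψ, fun p => ⟨aeval q p, ?_, ?_⟩⟩
  · have h1 : Ψ (aeval a p) = aeval (fun i => Ψ (a i)) p := by
      rw [← AlgHom.comp_apply, MvPolynomial.comp_aeval]
    have h2 : (aeval q p : LaurentSeries K) = aeval (fun i => j (q i)) p := by
      rw [← hj, ← AlgHom.comp_apply, MvPolynomial.comp_aeval]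
    have hfun : (fun i => Ψ (a i)) = fun i => j (q i) := funext fun i => by
      rw [hj]
      exact hq i
    rw [h1, h2, hfun]
  · have hhom : (PowerSeries.constantCoeff : PowerSeries K →+* K).comp
        (aeval q : MvPolynomial n K →ₐ[K] PowerSeries K).toRingHom =
        (aeval y : MvPolynomial n K →ₐ[K] K).toRingHom := by
      refine MvPolynomial.ringHom_ext (fun c => ?_) (fun i => ?_)
      · change PowerSeries.constantCoeff (aeval q (C c)) = aeval y (C c)
        rw [aeval_C, aeval_C, Algebra.algebraMap_self_apply]
        show PowerSeries.constantCoeff (PowerSeries.C c) = c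
        exact PowerSeries.constantCoeff_C c
      · change PowerSeries.constantCoeff (aeval q (X i)) = aeval y (X i)
        rw [aeval_X, aeval_X]
        exact hq0 i
    exact DFunLike.congr_fun hhom p

end Core

end LaurentPoints

/-- **BLMW 2011, Lemma 9.4.1 (Hilbert 1893; Kraft III.2.3 Lemma 1), DISCHARGED**: for
`f ∈ Δ(g) = \overline{GL_N(ℂ)·g}` there are `σ ∈ GL_N(ℂ((ε)))` and `F` over `ℂ[[ε]]` with
`σ·g = F` and `F(ε = 0) = f`. Assembly: `BLMW2011_lemma_9_4_1_of_core`
(`BLMW11HilbertKraftReduction.lean`: orbit closure → Laurent points of the image of `D(det)` →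
the algebraic core) and `LaurentPoints.exists_laurentSeries_aeval` (the core: curve selection à la
BCS (20.26)–(20.28) as in `AlderStrassenProofs.lean`, places of function fields in one variable,
power-series expansion of a discrete valuation ring with residue field `ℂ`).
[cite: BurgisserEtAl2011, Lemma 9.4.1] [cite: Kraft1984, III.2.3 Lemma 1] -/
theorem BLMW2011_lemma_9_4_1_holds : BLMW2011_lemma_9_4_1 := by
  refine BLMW2011_lemma_9_4_1_of_core ?_
  intro R _ _ _ _ n _ a y h
  exact LaurentPoints.exists_laurentSeries_aeval a y h

end Literature.Computability.AlgebraicComplexity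

end
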